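import Literature.AlgebraicTopology.SingularHomology.LinearLocalDegree
import Literature.AlgebraicTopology.SingularHomology.LocalHomologyVanishing
import Mathlib.Analysis.Calculus.FDeriv.Basic
import Mathlib.LinearAlgebra.Determinant
import HarnessLib

/-!
# The local degree of a `C¹` local homeomorphism of `ℝⁿ` is the sign of its Jacobian

A. Hatcher, *Algebraic Topology* (2002), §3.3, p. 233 (local orientations of `ℝⁿ` are
"preserved under rotations and reversed by reflections") and §2.2 Exercise 7 (an invertible
linear map acts on `Hₙ(ℝⁿ, ℝⁿ ∖ 0)` by the sign of its determinant, `…LinearLocalDegree`);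
G. Bredon, *Topology and Geometry* (1993), VI.7 and J. Milnor, J. Stasheff, *Characteristic
Classes* (1974), Appendix A, for the `C¹` version by linearization. For a homological
`ℤ`-orientation `g` of `𝔼 = EuclideanSpace ℝ (Fin n)`
(`Literature.AlgebraicTopology.SingularHomology.HomologicalOrientation`) we prove:

* `HomologicalOrientation.map_affine_localClass` — an invertible affine map `v ↦ b + A (v - p)`
  sends `g_p` to `g_b` if `det A > 0` and to `-g_b` if `det A < 0` (translations preserve every
  orientation of `ℝⁿ`, `HomologicalOrientation.map_addRight_localClass` of `…LocalDegreeSign`,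
  and the linear part acts by the sign of the determinant, `…LinearLocalDegree`);
* `exists_ball_lineHomotopy_ne`, `map_eq_map_affine_of_lineHomotopy_ne` — **linearization**:
  if `t` has an invertible derivative `A` at `p`, then on a small ball `B` around `p` the
  straight-line homotopy from `t` to its affine approximation `v ↦ t p + A (v - p)` is a
  homotopy of maps of pairs `(B, B ∖ p) → (ℝⁿ, ℝⁿ ∖ t p)`, so both induce the same map
  `Hₖ(B | p) → Hₖ(ℝⁿ | t p)`;
* **`HomologicalOrientation.localDegree_of_hasFDerivAt`** (and the case of a partial
  homeomorphism, `HomologicalOrientation.localDegree_openPartialHomeomorph`) — for `t` continuous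
  on an open `V ∋ p`, differentiable at `p` with `det Dt(p) ≠ 0` and `t v ≠ t p` on `V ∖ p`,
  pushing the local class `g_p` (excised to `V`) forward along `t` gives `g_{t p}` if
  `det Dt(p) > 0` and `-g_{t p}` if `det Dt(p) < 0`.

Everything is proved; no definitions and no named facts are introduced.

## References

* A. Hatcher, *Algebraic Topology*, CUP 2002, §2.2 Exercise 7, §3.3 p. 233. [HatcherAT2002]
* G. E. Bredon, *Topology and Geometry*, GTM 139, Springer 1993, VI.7. [Bredon1993]
* J. Milnor, J. Stasheff, *Characteristic Classes*, Princeton 1974, Appendix A.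
  [MilnorStasheff1974]
-/

noncomputable section

open CategoryTheory Limits Set Metric Filter Topology

namespace Literature.AlgebraicTopology.SingularHomology

variable {n : ℕ}

/-! ### Affine maps -/

namespace HomologicalOrientation

/-- **Invertible affine maps act on local orientation classes by the sign of the determinant**:
`v ↦ b + A (v - p)` sends `g_p` to `g_b` if `det A > 0` and to `-g_b` if `det A < 0`
(translations and Hatcher 2002, §2.2 Exercise 7, `…LinearLocalDegree`).
[cite: HatcherAT2002, §2.2 Exercise 7] -/
theorem map_affine_localClass (g : HomologicalOrientation ℤ (EuclideanSpace ℝ (Fin n)) n)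
    (A : EuclideanSpace ℝ (Fin n) →L[ℝ] EuclideanSpace ℝ (Fin n))
    (hA : LinearMap.det (A : EuclideanSpace ℝ (Fin n) →ₗ[ℝ] EuclideanSpace ℝ (Fin n)) ≠ 0)
    (p b : EuclideanSpace ℝ (Fin n))
    (hc : Continuous fun v : EuclideanSpace ℝ (Fin n) => b + A (v - p))
    (h : MapsTo (fun v : EuclideanSpace ℝ (Fin n) => b + A (v - p)) {p}ᶜ {b}ᶜ) :
    relativeSingularHomology.map ℤ ℤ (⟨fun v => b + A (v - p), hc⟩ : C(_, _)) h n (g.localClass p) =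
      if 0 < LinearMap.det (A : EuclideanSpace ℝ (Fin n) →ₗ[ℝ] EuclideanSpace ℝ (Fin n))
      then g.localClass b else -g.localClass b := by
  -- factor as `τ_b ∘ A ∘ τ_{-p}`
  have h₁ :
      MapsTo (Homeomorph.addRight (-p) : C(EuclideanSpace ℝ (Fin n), EuclideanSpace ℝ (Fin n)))
      {p}ᶜ {(0 : EuclideanSpace ℝ (Fin n))}ᶜ := by
    intro v hv h0
    apply hv
    have : v + -p = 0 := h0
    rw [mem_singleton_iff]; exact eq_of_sub_eq_zero (by rwa [sub_eq_add_neg])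
  have h₂ := mapsTo_continuousLinearMap_of_det_ne_zero hA
  have h₃ : MapsTo (Homeomorph.addRight b : C(EuclideanSpace ℝ (Fin n), EuclideanSpace ℝ (Fin n)))
      {(0 : EuclideanSpace ℝ (Fin n))}ᶜ {b}ᶜ := by
    intro v hv h0
    apply hv
    have : v + b = b := h0
    rw [mem_singleton_iff]; simpa using this
  have hfac :
      (⟨fun v => b + A (v - p), hc⟩ : C(EuclideanSpace ℝ (Fin n), EuclideanSpace ℝ (Fin n))) =
      (Homeomorph.addRight b : C(EuclideanSpace ℝ (Fin n), EuclideanSpace ℝ (Fin n))).comp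
        ((A : C(EuclideanSpace ℝ (Fin n), EuclideanSpace ℝ (Fin n))).comp
          (Homeomorph.addRight (-p) : C(EuclideanSpace ℝ (Fin n), EuclideanSpace ℝ (Fin n)))) := by
    ext v : 1
    change b + A (v - p) = A (v + -p) + b
    rw [← sub_eq_add_neg, add_comm]
  rw [relativeSingularHomology.map.congr_simp ℤ ℤ _ _ hfac h n,
    relativeSingularHomology.map_comp ℤ ℤ _ _ (h₂.comp h₁) h₃,
    relativeSingularHomology.map_comp ℤ ℤ _ _ h₁ h₂, ModuleCat.comp_apply, ModuleCat.comp_apply,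
    map_addRight_localClass g (-p) p 0 (add_neg_cancel p)]
  split_ifs with hdet
  · rw [localHomology_map_continuousLinearMap_of_det_pos A hdet, ModuleCat.id_apply,
      map_addRight_localClass g b 0 b (zero_add b)]
  · have hneg : LinearMap.det (A : EuclideanSpace ℝ (Fin n) →ₗ[ℝ] EuclideanSpace ℝ (Fin n)) < 0 :=
      lt_of_le_of_ne (not_lt.1 hdet) hA
    rw [localHomology_map_continuousLinearMap_of_det_neg A hneg]
    change relativeSingularHomology.map ℤ ℤ _ h₃ n (-(g.localClass 0)) = _
    rw [map_neg, map_addRight_localClass g b 0 b (zero_add b)]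

end HomologicalOrientation

/-! ### Linearization: a differentiable map is homotopic to its affine approximation near `p` -/

section Linearization

/-- **Linearization estimate.** If `t` has derivative `A` at `p` with `det A ≠ 0`, then on a small
ball around `p` (inside any given neighbourhood `U`) the segment from `t v` to the affine
approximation `t p + A (v - p)` avoids `t p` for `v ≠ p`: `‖A (v - p)‖ ≥ ‖v - p‖ / K` dominates
the error `o(‖v - p‖)` (Bredon 1993, VI.7; Milnor–Stasheff 1974, App. A: the local degree of a
`C¹` map with invertible Jacobian is that of its derivative). [cite: Bredon1993, VI.7] -/
theorem exists_ball_lineHomotopy_ne (t : EuclideanSpace ℝ (Fin n) → EuclideanSpace ℝ (Fin n))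
    {p : EuclideanSpace ℝ (Fin n)} {A : EuclideanSpace ℝ (Fin n) →L[ℝ] EuclideanSpace ℝ (Fin n)}
    (ht : HasFDerivAt t A p)
    (hA : LinearMap.det (A : EuclideanSpace ℝ (Fin n) →ₗ[ℝ] EuclideanSpace ℝ (Fin n)) ≠ 0)
    {U : Set (EuclideanSpace ℝ (Fin n))} (hU : U ∈ 𝓝 p) :
    ∃ r > 0, ball p r ⊆ U ∧ ∀ v ∈ ball p r, v ≠ p → ∀ s : ℝ, 0 ≤ s → s ≤ 1 →
      (1 - s) • t v + s • (t p + A (v - p)) ≠ t p := by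
  -- the lower bound `‖w‖ ≤ K ‖A w‖`
  have hA' : A.det ≠ 0 := hA
  set e := A.toContinuousLinearEquivOfDetNeZero hA' with he
  set K : ℝ := (‖(e.symm : EuclideanSpace ℝ (Fin n) →L[ℝ] EuclideanSpace ℝ (Fin n))‖₊ : ℝ) with hK
  have hK0 : 0 ≤ K := NNReal.coe_nonneg _
  have hlow : ∀ w, ‖w‖ ≤ K * ‖A w‖ := fun w => by
    have h1 := e.antilipschitz.le_mul_dist w 0
    rw [dist_zero_right, map_zero, dist_zero_right] at h1
    exact h1
  -- the error bound `‖t v - t p - A (v - p)‖ ≤ ε ‖v - p‖`, `ε = 1 / (2 (K + 1))`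
  set ε : ℝ := 1 / (2 * (K + 1)) with hε
  have hε0 : 0 < ε := by rw [hε]; positivity
  have hKε : K * ε ≤ 1 / 2 := by
    rw [hε, div_eq_mul_inv, one_mul, ← div_eq_mul_inv, div_le_iff₀ (by positivity)]
    nlinarith
  have hev : ∀ᶠ v in 𝓝 p, ‖t v - t p - A (v - p)‖ ≤ ε * ‖v - p‖ := ht.isLittleO.def hε0
  obtain ⟨r, hr, hball⟩ := Metric.nhds_basis_ball.mem_iff.1 (Filter.inter_mem hU hev)
  refine ⟨r, hr, fun v hv => (hball hv).1, fun v hv hvp s hs0 hs1 h0 => ?_⟩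
  have hR : ‖t v - t p - A (v - p)‖ ≤ ε * ‖v - p‖ := (hball hv).2
  -- from the equality, `A (v - p) = -(1 - s) • (t v - t p - A (v - p))`
  have hAvp : A (v - p) = -((1 - s) • (t v - t p - A (v - p))) := by
    have e1 : (1 - s) • t v + s • (t p + A (v - p)) - t p =
        (1 - s) • (t v - t p - A (v - p)) + A (v - p) := by
      simp only [smul_sub, smul_add, sub_smul, one_smul]
      abel
    rw [h0, sub_self] at e1
    exact eq_neg_of_add_eq_zero_right e1.symm
  have h1 : ‖A (v - p)‖ ≤ ε * ‖v - p‖ := by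
    rw [hAvp, norm_neg, norm_smul, Real.norm_eq_abs, abs_of_nonneg (by linarith)]
    calc (1 - s) * ‖t v - t p - A (v - p)‖ ≤ 1 * ‖t v - t p - A (v - p)‖ := by
          gcongr; linarith
      _ ≤ ε * ‖v - p‖ := by rw [one_mul]; exact hR
  have h2 : ‖v - p‖ ≤ K * ε * ‖v - p‖ := by
    calc ‖v - p‖ ≤ K * ‖A (v - p)‖ := hlow _
      _ ≤ K * (ε * ‖v - p‖) := by gcongr
      _ = K * ε * ‖v - p‖ := by ring
  have hpos : 0 < ‖v - p‖ := norm_pos_iff.2 (sub_ne_zero.2 hvp)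
  nlinarith

/-- **The straight-line homotopy to the affine approximation is a homotopy of maps of pairs**
`(B, B ∖ p) → (ℝⁿ, ℝⁿ ∖ t p)` on a ball `B` as in `exists_ball_lineHomotopy_ne`, so `t|_B` and
`v ↦ t p + A (v - p)` induce the same map `Hₖ(B | p) → Hₖ(ℝⁿ | t p)` (homotopy invariance for
pairs, `relativeSingularHomology.map_eq_of_homotopic_holds`; Bredon 1993, VI.7).
[cite: Bredon1993, VI.7] -/
theorem map_eq_map_affine_of_lineHomotopy_ne
    {t : EuclideanSpace ℝ (Fin n) → EuclideanSpace ℝ (Fin n)} {p : EuclideanSpace ℝ (Fin n)}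
    {A : EuclideanSpace ℝ (Fin n) →L[ℝ] EuclideanSpace ℝ (Fin n)} {r : ℝ} (hr : 0 < r)
    (htc : ContinuousOn t (ball p r))
    (hne : ∀ v ∈ ball p r, v ≠ p → ∀ s : ℝ, 0 ≤ s → s ≤ 1 →
      (1 - s) • t v + s • (t p + A (v - p)) ≠ t p)
    (h₀ : MapsTo (fun v : ↥(ball p r) => t v)
      {(⟨p, mem_ball_self hr⟩ : ↥(ball p r))}ᶜ {t p}ᶜ)
    (h₁ : MapsTo (fun v : ↥(ball p r) => t p + A (v - p))
      {(⟨p, mem_ball_self hr⟩ : ↥(ball p r))}ᶜ {t p}ᶜ) (k : ℕ) :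
    relativeSingularHomology.map ℤ ℤ
        (⟨fun v : ↥(ball p r) => t v, htc.restrict⟩ : C(↥(ball p r), EuclideanSpace ℝ (Fin n)))
        h₀ k =
      relativeSingularHomology.map ℤ ℤ
        (⟨fun v : ↥(ball p r) => t p + A (v - p), by fun_prop⟩ :
          C(↥(ball p r), EuclideanSpace ℝ (Fin n))) h₁ k := by
  let F : ContinuousMap.Homotopy
      (⟨fun v : ↥(ball p r) => t v, htc.restrict⟩ : C(↥(ball p r), EuclideanSpace ℝ (Fin n)))
      (⟨fun v : ↥(ball p r) => t p + A (v - p), by fun_prop⟩ :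
        C(↥(ball p r), EuclideanSpace ℝ (Fin n))) :=
    { toFun := fun q => (1 - (q.1 : ℝ)) • t q.2 + (q.1 : ℝ) • (t p + A (q.2 - p))
      continuous_toFun := by
        have hc : Continuous fun q : unitInterval × ↥(ball p r) => t q.2 :=
          htc.restrict.comp continuous_snd
        have hs : Continuous fun q : unitInterval × ↥(ball p r) => (q.1 : ℝ) :=
          continuous_subtype_val.comp continuous_fst
        exact ((continuous_const.sub hs).smul hc).add
          (hs.smul (continuous_const.add (A.continuous.comp
            ((continuous_subtype_val.comp continuous_snd).sub continuous_const))))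
      map_zero_left := fun v => by
        change (1 - ((0 : unitInterval) : ℝ)) • t v + ((0 : unitInterval) : ℝ) • (t p + A (v - p)) =
          t v
        rw [Set.Icc.coe_zero, sub_zero, one_smul, zero_smul, add_zero]
      map_one_left := fun v => by
        change (1 - ((1 : unitInterval) : ℝ)) • t v + ((1 : unitInterval) : ℝ) • (t p + A (v - p)) =
          t p + A (v - p)
        rw [Set.Icc.coe_one, sub_self, zero_smul, one_smul, zero_add] }
  refine relativeSingularHomology.map_eq_of_homotopic_holds ℤ ℤ h₀ h₁ F (fun q hq => ?_) k
  have hvp : (q.2 : EuclideanSpace ℝ (Fin n)) ≠ p := fun h => hq (Subtype.ext h)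
  exact hne q.2 q.2.2 hvp q.1 q.1.2.1 q.1.2.2

end Linearization

/-! ### The local degree of a `C¹` local homeomorphism -/

namespace HomologicalOrientation

/-- **The local degree of a differentiable local homeomorphism of `ℝⁿ` is the sign of its
Jacobian determinant.** Let `g` be a `ℤ`-orientation of `ℝⁿ`, `V ⊆ ℝⁿ` open, `t : ℝⁿ → ℝⁿ`
continuous on `V` and differentiable at `p ∈ V` with derivative `A`, `det A ≠ 0`, and
`t v ≠ t p` for `v ∈ V ∖ p` (a map of pairs `(V, V ∖ p) → (ℝⁿ, ℝⁿ ∖ q)`, `q = t p`). Pushing the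
local orientation class `g_p` — excised to `V` — forward along `t` gives `g_q` if `det A > 0` and
`-g_q` if `det A < 0` (Bredon 1993, VI.7; Milnor–Stasheff 1974, App. A; Hatcher 2002, §3.3 p. 233
with §2.2 Exercise 7). Proof: shrink to a ball on which `t` is homotopic through maps of pairs to
its affine approximation (`map_eq_map_affine_of_lineHomotopy_ne`), which acts by the sign of
`det A` (`map_affine_localClass`). [cite: Bredon1993, VI.7] -/
theorem localDegree_of_hasFDerivAt
    (g : HomologicalOrientation ℤ (EuclideanSpace ℝ (Fin n)) n)
    (t : EuclideanSpace ℝ (Fin n) → EuclideanSpace ℝ (Fin n)) {V : Set (EuclideanSpace ℝ (Fin n))}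
    (hV : IsOpen V) {p : EuclideanSpace ℝ (Fin n)} (hp : p ∈ V) (htc : ContinuousOn t V)
    {A : EuclideanSpace ℝ (Fin n) →L[ℝ] EuclideanSpace ℝ (Fin n)} (ht : HasFDerivAt t A p)
    (hA : LinearMap.det (A : EuclideanSpace ℝ (Fin n) →ₗ[ℝ] EuclideanSpace ℝ (Fin n)) ≠ 0)
    {q : EuclideanSpace ℝ (Fin n)} (hq : t p = q)
    (h : MapsTo (fun v : ↥V => t v) {(⟨p, hp⟩ : ↥V)}ᶜ {q}ᶜ) :
    relativeSingularHomology.map ℤ ℤ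
        (⟨fun v : ↥V => t v, htc.restrict⟩ : C(↥V, EuclideanSpace ℝ (Fin n))) h n
        ((localHomology.openSubsetIso ℤ ℤ hV hp n).inv (g.localClass p)) =
      if 0 < LinearMap.det (A : EuclideanSpace ℝ (Fin n) →ₗ[ℝ] EuclideanSpace ℝ (Fin n))
      then g.localClass q else -g.localClass q := by
  subst hq
  obtain ⟨r, hr, hball, hne⟩ := exists_ball_lineHomotopy_ne t ht hA (hV.mem_nhds hp)
  have hpB : p ∈ ball p r := mem_ball_self hr
  have htcB : ContinuousOn t (ball p r) := htc.mono hball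
  -- the inclusion `ι : B → V` and the excision isomorphisms
  let ι : C(↥(ball p r), ↥V) := ⟨Set.inclusion hball, continuous_inclusion hball⟩
  have hι : MapsTo ι {(⟨p, hpB⟩ : ↥(ball p r))}ᶜ {(⟨p, hp⟩ : ↥V)}ᶜ := by
    intro v hv hv'
    apply hv
    rw [mem_singleton_iff] at hv' ⊢
    have e1 : ((ι v : ↥V) : EuclideanSpace ℝ (Fin n)) = p := congrArg Subtype.val hv'
    exact Subtype.ext e1
  have hfac : (localHomology.openSubsetIso ℤ ℤ (isOpen_ball) hpB n).hom =
      relativeSingularHomology.map ℤ ℤ ι hι n ≫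
        (localHomology.openSubsetIso ℤ ℤ hV hp n).hom := by
    change relativeSingularHomology.map ℤ ℤ (subsetIncl (ball p r)) _ n =
      relativeSingularHomology.map ℤ ℤ ι hι n ≫
        relativeSingularHomology.map ℤ ℤ (subsetIncl V) _ n
    rw [← relativeSingularHomology.map_comp]
    rfl
  set x := (localHomology.openSubsetIso ℤ ℤ (isOpen_ball) hpB n).inv (g.localClass p) with hx
  have hx' : (localHomology.openSubsetIso ℤ ℤ hV hp n).inv (g.localClass p) =
      relativeSingularHomology.map ℤ ℤ ι hι n x := by
    have e1 : (localHomology.openSubsetIso ℤ ℤ (isOpen_ball) hpB n).hom x = g.localClass p := by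
      rw [hx, ← ModuleCat.comp_apply, Iso.inv_hom_id, ModuleCat.id_apply]
    rw [← e1, hfac, ModuleCat.comp_apply, ← ModuleCat.comp_apply _ (localHomology.openSubsetIso
      ℤ ℤ hV hp n).inv, Iso.hom_inv_id, ModuleCat.id_apply]
  -- maps of pairs out of the ball
  have h₀ : MapsTo (fun v : ↥(ball p r) => t v) {(⟨p, hpB⟩ : ↥(ball p r))}ᶜ {t p}ᶜ :=
    fun v hv => h (hι hv)
  have hAinj : ∀ w, A w = 0 → w = 0 := fun w hw => by
    by_contra hw0
    exact mapsTo_continuousLinearMap_of_det_ne_zero hA hw0 hw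
  have h₁ : MapsTo (fun v : ↥(ball p r) => t p + A (v - p)) {(⟨p, hpB⟩ : ↥(ball p r))}ᶜ
      {t p}ᶜ := by
    intro v hv hv'
    apply hv
    rw [mem_singleton_iff] at hv' ⊢
    apply Subtype.ext
    have : A (v - p) = 0 := by
      have := hv'; rw [add_eq_left] at this; exact this
    exact eq_of_sub_eq_zero (hAinj _ this)
  have hL : MapsTo (fun v : EuclideanSpace ℝ (Fin n) => t p + A (v - p)) {p}ᶜ {t p}ᶜ := by
    intro v hv hv'
    apply hv
    rw [mem_singleton_iff] at hv' ⊢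
    have : A (v - p) = 0 := by
      have := hv'; rw [add_eq_left] at this; exact this
    exact eq_of_sub_eq_zero (hAinj _ this)
  -- `t ∘ val_V ∘ ι = t ∘ val_B`
  have hcomp : relativeSingularHomology.map ℤ ℤ ι hι n ≫
      relativeSingularHomology.map ℤ ℤ
        (⟨fun v : ↥V => t v, htc.restrict⟩ : C(↥V, EuclideanSpace ℝ (Fin n))) h n =
      relativeSingularHomology.map ℤ ℤ
        (⟨fun v : ↥(ball p r) => t v, htcB.restrict⟩ : C(↥(ball p r), EuclideanSpace ℝ (Fin n)))
        h₀ n := by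
    rw [← relativeSingularHomology.map_comp]
    rfl
  -- the affine map factors through the inclusion of the ball into `ℝⁿ`
  have hcompL : relativeSingularHomology.map ℤ ℤ
      (⟨fun v : ↥(ball p r) => t p + A (v - p), by fun_prop⟩ :
        C(↥(ball p r), EuclideanSpace ℝ (Fin n))) h₁ n =
      (localHomology.openSubsetIso ℤ ℤ (isOpen_ball) hpB n).hom ≫
        relativeSingularHomology.map ℤ ℤ
          (⟨fun v : EuclideanSpace ℝ (Fin n) => t p + A (v - p), by fun_prop⟩ : C(_, _)) hL n := by
    change _ = relativeSingularHomology.map ℤ ℤ (subsetIncl (ball p r)) _ n ≫ _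
    rw [← relativeSingularHomology.map_comp]
    rfl
  rw [hx', ← ModuleCat.comp_apply, hcomp, map_eq_map_affine_of_lineHomotopy_ne hr htcB hne h₀ h₁ n,
    hcompL, ModuleCat.comp_apply, hx, ← ModuleCat.comp_apply _ (localHomology.openSubsetIso ℤ ℤ
      (isOpen_ball) hpB n).hom, Iso.inv_hom_id, ModuleCat.id_apply]
  exact map_affine_localClass g A hA p (t p) (by fun_prop) hL

/-- **The local degree of a differentiable partial homeomorphism of `ℝⁿ`** at a point of its
source is the sign of its Jacobian determinant there: the case `V = t.source` of
`localDegree_of_hasFDerivAt` (Bredon 1993, VI.7; Hatcher 2002, §3.3 p. 233).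
[cite: Bredon1993, VI.7] -/
theorem localDegree_openPartialHomeomorph
    (g : HomologicalOrientation ℤ (EuclideanSpace ℝ (Fin n)) n)
    (t : OpenPartialHomeomorph (EuclideanSpace ℝ (Fin n)) (EuclideanSpace ℝ (Fin n)))
    {p : EuclideanSpace ℝ (Fin n)} (hp : p ∈ t.source)
    {A : EuclideanSpace ℝ (Fin n) →L[ℝ] EuclideanSpace ℝ (Fin n)} (ht : HasFDerivAt t A p)
    (hA : LinearMap.det (A : EuclideanSpace ℝ (Fin n) →ₗ[ℝ] EuclideanSpace ℝ (Fin n)) ≠ 0)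
    (h : MapsTo (fun v : ↥t.source => t v) {(⟨p, hp⟩ : ↥t.source)}ᶜ {t p}ᶜ) :
    relativeSingularHomology.map ℤ ℤ
        (⟨fun v : ↥t.source => t v, t.continuousOn.restrict⟩ :
          C(↥t.source, EuclideanSpace ℝ (Fin n))) h n
        ((localHomology.openSubsetIso ℤ ℤ t.open_source hp n).inv (g.localClass p)) =
      if 0 < LinearMap.det (A : EuclideanSpace ℝ (Fin n) →ₗ[ℝ] EuclideanSpace ℝ (Fin n))
      then g.localClass (t p) else -g.localClass (t p) :=
  localDegree_of_hasFDerivAt g t t.open_source hp t.continuousOn ht hA rfl h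

end HomologicalOrientation

end Literature.AlgebraicTopology.SingularHomology
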